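import Summits.MatrixMultiplication.OmegaCensus.STPPVosperTilingWordsPrunedQ

/-!
# ω-census (abelian STPP census): the pairwise-pruned block enumerator RETURNING THE SETS (for the full-family Def-5.1 stage) and its soundness (kernel)

HONEST FRAMING (pub-omega census; verbatim): lottery ticket; floor = certified bounds/negative ranges.
Census STRUCTURE (seat pub-omega-stpp-2 gen 26, 2026-08-28; RULING L37-135 'CoreB'), family (b2).  `blockDiffsWQ` (`STPPVosperTilingWordsPrunedQ.lean`) lists
the VALUE TRIPLES `(C − B, C − A, A − B)` of the candidate placements of one block against the Y-points `YL` and Z-points `ZL`; the last stage of the slack-`s`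
partition law on one-other-block leaves (seat stpp-1's SLACK2-DESIGN.md, π-free by the gauge of `STPPVosperSlackPairingGauge.lean`) needs the candidate SETS
`(A, B, C)` themselves (value lists, `0 ∈ B`, `C ⊆ YL`), to assemble two-block families and decide Def. 5.1 on them.  `blockSetsWQ` is the same comprehension
with the output `(A, 0 :: B′, C)`; `blockSetsWQ_complete` is `blockEnumSound_blockDiffsWQ` with the conclusion "the lists realising the block are in the output".
Nothing here is progress on `ω`.

References: H. Cohn, R. Kleinberg, B. Szegedy, C. Umans, FOCS 2005 (arXiv:math/0511460), Def. 5.1.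
-/

open Finset
open scoped Pointwise

namespace Summit.MatrixMultiplication.OmegaCensus.CubeNB

open Literature.Computability.AlgebraicComplexity
open Literature.Combinatorics.Additive
open Summit.MatrixMultiplication.OmegaCensus.STPPKneser

section Sets

/-- **Pairwise-pruned block enumerator returning the sets.**  As `blockDiffsWQ`, but each surviving candidate is returned as the triple of value lists
`(A, 0 :: B′, C)` (instead of its difference lists). [folklore] -/
def blockSetsWQ (p : ℕ) (YL ZL : List ℕ) (a b c : ℕ) : List (List ℕ × List ℕ × List ℕ) :=
  (extC p YL ZL a (b - 1) YL c [] ((List.range p).filter fun x => x != 0) (List.range p)).flatMap fun T =>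
    ((T.2.1.filter (bOK p T.1)).sublistsLen (b - 1)).flatMap fun B' =>
      if (diffList p T.1 (0 :: B')).Nodup then
        (extA (aPairOK p YL T.1 (0 :: B')) (T.2.2.filter (aOK3 p ZL T.1 (0 :: B'))) a []).filterMap fun A =>
          if (blockTriple p YL ZL T.1 (0 :: B') A).isSome then some (A, 0 :: B', T.1) else none
      else []

/-- Membership in `blockSetsWQ` (the witnesses spelled out). [folklore] -/
theorem mem_blockSetsWQ {p : ℕ} {YL ZL : List ℕ} {a b c : ℕ} {C cB cA B' A : List ℕ}
    (hT : (C, cB, cA) ∈ extC p YL ZL a (b - 1) YL c [] ((List.range p).filter fun x => x != 0) (List.range p))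
    (hB : B' ∈ (cB.filter (bOK p C)).sublistsLen (b - 1))
    (hA : A ∈ extA (aPairOK p YL C (0 :: B')) (cA.filter (aOK3 p ZL C (0 :: B'))) a [])
    (h1 : (diffList p C (0 :: B')).Nodup) (h2 : (diffList p C A).Nodup) (h3 : (diffList p A (0 :: B')).Nodup)
    (hw : wordsIn p YL ZL C (0 :: B') A = true) :
    (A, 0 :: B', C) ∈ blockSetsWQ p YL ZL a b c := by
  rw [blockSetsWQ, List.mem_flatMap]
  refine ⟨(C, cB, cA), hT, ?_⟩
  rw [List.mem_flatMap]
  refine ⟨B', hB, ?_⟩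
  simp only [h1, if_true]
  rw [List.mem_filterMap]
  refine ⟨A, hA, ?_⟩
  simp [blockTriple, h1, h2, h3, hw]

/-- **Completeness of `blockSetsWQ`.**  Under the hypotheses of `BlockEnumSound` for one block (value finsets `Av, Bv, Cv ⊆ [0,p)` of sizes `(a,b,c)`,
`0 ∈ Bv`, `C − B` inside the duplicate-free `YL`, `C − A` inside `ZL`, injective difference maps, the three within-block words), there are lists `Al, Bl, Cl`
enumerating the three finsets with `(Al, Bl, Cl) ∈ blockSetsWQ p YL ZL a b c`. [folklore] -/
theorem blockSetsWQ_complete (p : ℕ) (YL ZL : List ℕ) (hYL : YL.Nodup) (a b c : ℕ) (Av Bv Cv : Finset ℕ)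
    (hszA : #Av = a) (hszB : #Bv = b) (hszC : #Cv = c)
    (hAp : ∀ x ∈ Av, x < p) (hBp : ∀ x ∈ Bv, x < p) (hCp : ∀ x ∈ Cv, x < p) (hB0 : 0 ∈ Bv)
    (hY : ∀ c ∈ Cv, ∀ x ∈ Bv, (c + p - x) % p ∈ YL) (hZ : ∀ c ∈ Cv, ∀ x ∈ Av, (c + p - x) % p ∈ ZL)
    (hinjY : ∀ c ∈ Cv, ∀ c' ∈ Cv, ∀ x ∈ Bv, ∀ x' ∈ Bv, (c + p - x) % p = (c' + p - x') % p → c = c' ∧ x = x')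
    (hinjZ : ∀ c ∈ Cv, ∀ c' ∈ Cv, ∀ x ∈ Av, ∀ x' ∈ Av, (c + p - x) % p = (c' + p - x') % p → c = c' ∧ x = x')
    (hinjX : ∀ c ∈ Av, ∀ c' ∈ Av, ∀ x ∈ Bv, ∀ x' ∈ Bv, (c + p - x) % p = (c' + p - x') % p → c = c' ∧ x = x')
    (hw1 : ∀ a₁ ∈ Av, ∀ a₂ ∈ Av, a₁ ≠ a₂ → ∀ y ∈ Bv, ∀ c ∈ Cv, ((a₁ + p - y) % p + (c + p - a₂) % p) % p ∉ YL)
    (hw2 : ∀ b₁ ∈ Bv, ∀ b₂ ∈ Bv, b₁ ≠ b₂ → ∀ c ∈ Cv, ∀ x ∈ Av, ((c + p - b₁) % p + p - (x + p - b₂) % p) % p ∉ ZL)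
    (hw3 : ∀ c₁ ∈ Cv, ∀ c₂ ∈ Cv, c₁ ≠ c₂ → ∀ y ∈ Bv, ∀ x ∈ Av, ∀ x' ∈ Av, ∀ y' ∈ Bv,
      ((c₁ + p - y) % p + p - (c₂ + p - x) % p) % p ≠ (x' + p - y') % p) :
    ∃ Al Bl Cl : List ℕ, (∀ x, x ∈ Al ↔ x ∈ Av) ∧ (∀ x, x ∈ Bl ↔ x ∈ Bv) ∧ (∀ x, x ∈ Cl ↔ x ∈ Cv) ∧
      (Al, Bl, Cl) ∈ blockSetsWQ p YL ZL a b c := by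
  -- the list realising C, in the order of YL
  have hCsub : ∀ x ∈ Cv, x ∈ YL := by
    intro x hx
    have h := hY x hx 0 hB0
    rwa [Nat.sub_zero, Nat.add_mod_right, Nat.mod_eq_of_lt (hCp x hx)] at h
  set Cl := YL.filter (fun x => decide (x ∈ Cv)) with hCl
  have hClmem : ∀ x, x ∈ Cl ↔ x ∈ Cv := by
    intro x; rw [hCl, List.mem_filter, decide_eq_true_eq]; exact ⟨fun h => h.2, fun h => ⟨hCsub x h, h⟩⟩
  have hClnd : Cl.Nodup := hYL.filter _
  have hCllen : Cl.length = c := by rw [hCl, length_filter_mem_of_subset hYL hCsub, hszC]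
  -- the pruned search reaches (Cl, cB*, cA*)
  set cB₀ := (List.range p).filter (fun x => x != 0) with hcB₀
  set cA₀ := List.range p with hcA₀
  have hcB₀nd : cB₀.Nodup := (List.nodup_range).filter _
  have hcA₀nd : cA₀.Nodup := List.nodup_range
  have hsB₀ : ∀ x ∈ Bv.erase 0, x ∈ cB₀ := by
    intro x hx
    rw [Finset.mem_erase] at hx
    rw [hcB₀, List.mem_filter, List.mem_range]
    exact ⟨hBp x hx.2, by simpa using hx.1⟩
  have hsA₀ : ∀ x ∈ Av, x ∈ cA₀ := fun x hx => List.mem_range.2 (hAp x hx)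
  have hYe : ∀ c' ∈ Cv, ∀ x ∈ Bv.erase 0, (c' + p - x) % p ∈ YL := fun c' hc' x hx => hY c' hc' x (Finset.mem_of_mem_erase hx)
  have hext := mem_extC (YL := YL) (ZL := ZL) Cv (Bv.erase 0) Av (by rw [Finset.card_erase_of_mem hB0, hszB]) hszA hYe hZ
    YL [] cB₀ cA₀ hcB₀nd hcA₀nd hsB₀ hsA₀
  rw [List.nil_append, ← hCl, hCllen] at hext
  set cBf := keepAll p YL Cl cB₀ with hcBf
  set cAf := keepAll p ZL Cl cA₀ with hcAf
  have hBsub : ∀ x ∈ Bv.erase 0, x ∈ cBf := fun x hx =>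
    mem_keepAll.2 ⟨hsB₀ x hx, fun y hy => hYe y ((hClmem y).1 hy) x hx⟩
  have hAsub : ∀ x ∈ Av, x ∈ cAf := fun x hx =>
    mem_keepAll.2 ⟨hsA₀ x hx, fun y hy => hZ y ((hClmem y).1 hy) x hx⟩
  have hcBfnd : cBf.Nodup := nodup_keepAll hcB₀nd
  have hcAfnd : cAf.Nodup := nodup_keepAll hcA₀nd
  -- the B′-candidates passing the unary pre-test
  set cBg := cBf.filter (bOK p Cl) with hcBg
  have hBsubg : ∀ x ∈ Bv.erase 0, x ∈ cBg := by
    intro x hx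
    rw [hcBg, List.mem_filter]
    refine ⟨hBsub x hx, bOK_of_forall fun c' hc' hmem => ?_⟩
    obtain ⟨hx0, hxB⟩ := Finset.mem_erase.1 hx
    have heq : (c' + p - x) % p = ((c' + p - x) % p + p - 0) % p := by
      rw [Nat.sub_zero, Nat.add_mod_right, Nat.mod_mod]
    exact hx0 (hinjY c' ((hClmem _).1 hc') _ ((hClmem _).1 hmem) x hxB 0 hB0 heq).2
  have hcBgnd : cBg.Nodup := hcBfnd.filter _
  -- the list realising B′
  set Bl := cBg.filter (fun x => decide (x ∈ Bv.erase 0)) with hBl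
  have hBlmem : ∀ x, x ∈ Bl ↔ x ∈ Bv.erase 0 := by
    intro x; rw [hBl, List.mem_filter, decide_eq_true_eq]; exact ⟨fun h => h.2, fun h => ⟨hBsubg x h, h⟩⟩
  have hBlnd : Bl.Nodup := hcBgnd.filter _
  have hBllen : Bl.length = b - 1 := by
    rw [hBl, length_filter_mem_of_subset hcBgnd hBsubg, Finset.card_erase_of_mem hB0, hszB]
  have hB0l : ∀ x, x ∈ (0 :: Bl) ↔ x ∈ Bv := by
    intro x; rw [List.mem_cons, hBlmem, Finset.mem_erase]
    constructor
    · rintro (rfl | ⟨-, h⟩); exacts [hB0, h]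
    · intro h; by_cases h0 : x = 0; exacts [Or.inl h0, Or.inr ⟨h0, h⟩]
  have hB0nd : (0 :: Bl).Nodup := by
    rw [List.nodup_cons]; refine ⟨fun h => ?_, hBlnd⟩
    have := (hBlmem 0).1 h; simp at this
  -- the A-candidates passing the unary pre-tests
  set cAg := cAf.filter (aOK3 p ZL Cl (0 :: Bl)) with hcAg
  have hAsubg : ∀ x ∈ Av, x ∈ cAg := fun x hx => by
    rw [hcAg, List.mem_filter]
    exact ⟨hAsub x hx, aOK3_of_forall
      (fun b₁ hb₁ b₂ hb₂ hne c' hc' => hw2 b₁ ((hB0l _).1 hb₁) b₂ ((hB0l _).1 hb₂) hne c' ((hClmem _).1 hc') x hx)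
      (fun c₁ hc₁ c₂ hc₂ hne y hy y' hy' =>
        hw3 c₁ ((hClmem _).1 hc₁) c₂ ((hClmem _).1 hc₂) hne y ((hB0l _).1 hy) x hx x hx y' ((hB0l _).1 hy'))⟩
  have hcAgnd : cAg.Nodup := hcAfnd.filter _
  set Al := cAg.filter (fun x => decide (x ∈ Av)) with hAl
  have hAlmem : ∀ x, x ∈ Al ↔ x ∈ Av := by
    intro x; rw [hAl, List.mem_filter, decide_eq_true_eq]; exact ⟨fun h => h.2, fun h => ⟨hAsubg x h, h⟩⟩
  have hAlnd : Al.Nodup := hcAgnd.filter _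
  have hAllen : Al.length = a := by rw [hAl, length_filter_mem_of_subset hcAgnd hAsubg, hszA]
  -- the real A is a clique of the pairwise tests, reached by extA
  have hpair : ∀ x ∈ Av, ∀ x' ∈ Av, x ≠ x' → aPairOK p YL Cl (0 :: Bl) x x' = true := fun x hx x' hx' hne =>
    aPairOK_of_forall
      (fun c₁ hc₁ c₂ hc₂ heq => hne (hinjZ c₁ ((hClmem _).1 hc₁) c₂ ((hClmem _).1 hc₂) x hx x' hx' heq).2)
      (fun y hy y' hy' heq => hne (hinjX x hx x' hx' y ((hB0l _).1 hy) y' ((hB0l _).1 hy') heq).1)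
      (fun y hy c₁ hc₁ => ⟨hw1 x hx x' hx' hne y ((hB0l _).1 hy) c₁ ((hClmem _).1 hc₁),
        hw1 x' hx' x hx (Ne.symm hne) y ((hB0l _).1 hy) c₁ ((hClmem _).1 hc₁)⟩)
      (fun c₁ hc₁ c₂ hc₂ hne' y hy y' hy' =>
        ⟨hw3 c₁ ((hClmem _).1 hc₁) c₂ ((hClmem _).1 hc₂) hne' y ((hB0l _).1 hy) x hx x' hx' y' ((hB0l _).1 hy'),
          hw3 c₁ ((hClmem _).1 hc₁) c₂ ((hClmem _).1 hc₂) hne' y ((hB0l _).1 hy) x' hx' x hx y' ((hB0l _).1 hy')⟩)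
  have hextA : Al ∈ extA (aPairOK p YL Cl (0 :: Bl)) cAg a [] := by
    have h := mem_extA (ok := aPairOK p YL Cl (0 :: Bl)) Av hpair cAg [] hcAgnd (fun a ha => by simp at ha)
    rw [List.nil_append, ← hAl, hAllen] at h
    exact h
  -- the three difference lists are duplicate-free
  have hn1 : (diffList p Cl (0 :: Bl)).Nodup := nodup_diffList hClnd hB0nd fun c₁ hc₁ c₂ hc₂ x₁ hx₁ x₂ hx₂ h =>
    hinjY c₁ ((hClmem _).1 hc₁) c₂ ((hClmem _).1 hc₂) x₁ ((hB0l _).1 hx₁) x₂ ((hB0l _).1 hx₂) h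
  have hn2 : (diffList p Cl Al).Nodup := nodup_diffList hClnd hAlnd fun c₁ hc₁ c₂ hc₂ x₁ hx₁ x₂ hx₂ h =>
    hinjZ c₁ ((hClmem _).1 hc₁) c₂ ((hClmem _).1 hc₂) x₁ ((hAlmem _).1 hx₁) x₂ ((hAlmem _).1 hx₂) h
  have hn3 : (diffList p Al (0 :: Bl)).Nodup := nodup_diffList hAlnd hB0nd fun c₁ hc₁ c₂ hc₂ x₁ hx₁ x₂ hx₂ h =>
    hinjX c₁ ((hAlmem _).1 hc₁) c₂ ((hAlmem _).1 hc₂) x₁ ((hB0l _).1 hx₁) x₂ ((hB0l _).1 hx₂) h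
  -- the within-block words
  have hw : wordsIn p YL ZL Cl (0 :: Bl) Al = true := by
    refine wordsIn_of_forall (fun a₁ ha₁ a₂ ha₂ hne y hy c' hc' => ?_) (fun b₁ hb₁ b₂ hb₂ hne c' hc' x hx => ?_)
      (fun c₁ hc₁ c₂ hc₂ hne y hy x hx hmem => ?_)
    · exact hw1 a₁ ((hAlmem _).1 ha₁) a₂ ((hAlmem _).1 ha₂) hne y ((hB0l _).1 hy) c' ((hClmem _).1 hc')
    · exact hw2 b₁ ((hB0l _).1 hb₁) b₂ ((hB0l _).1 hb₂) hne c' ((hClmem _).1 hc') x ((hAlmem _).1 hx)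
    · obtain ⟨x', hx', y', hy', h⟩ := mem_diffList.1 hmem
      exact hw3 c₁ ((hClmem _).1 hc₁) c₂ ((hClmem _).1 hc₂) hne y ((hB0l _).1 hy) x ((hAlmem _).1 hx) x' ((hAlmem _).1 hx')
        y' ((hB0l _).1 hy') h.symm
  exact ⟨Al, 0 :: Bl, Cl, hAlmem, hB0l, hClmem, mem_blockSetsWQ hext (List.mem_sublistsLen.2 ⟨List.filter_sublist, hBllen⟩) hextA
    hn1 hn2 hn3 hw⟩

end Sets

end Summit.MatrixMultiplication.OmegaCensus.CubeNB
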